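import Literature.NumberTheory.LFunctions.LaplaceShapeIBP
import Literature.NumberTheory.LFunctions.SmoothedExplicitFormulaContour
import Mathlib.Analysis.SpecialFunctions.SmoothTransition
import HarnessLib

/-!
# Heath-Brown's test functions for the Deuring–Heilbronn phenomenon

Topic `Literature/NumberTheory/LFunctions`, sub-namespace `DHTest`. Everything in this file is
PROVED; the four definitions are the explicit construction of a smoothing of Heath-Brown's triangle
`f(t) = x₀ − t` (Heath-Brown 1992, §8, Lemma 8.1: "we choose `f(t) = x₀ − t` in Lemma 6.1 …") that
satisfies the smoothness hypotheses of the exact explicit formulae of the tree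
(`IsSmoothedEFTest`, Ford 2002 Lemma 4.5) and Heath-Brown's Conditions 1–2 of §7:

* `plateau x₀ ε₂ t = smoothTransition((x₀ − t)/ε₂)` — smooth, `1` on `t ≤ x₀ − ε₂`, `0` on `t ≥ x₀`,
  decreasing;
* `tri x₀ ε₂ t = ∫_t^{x₀} plateau` — a smoothed triangle: smooth, `= 0` on `[x₀, ∞)`, convex,
  `x₀ − ε₂ − t ≤ tri t ≤ x₀ − t`;
* `shape x₀ ε₂ ε₀ t = tri(t) e^{−ε₀ t}` — the shape `h`; **Condition 2 with room**:
  `Re ∫₀^{x₀} h(t) e^{−wt} dt ≥ 0` whenever `Re w ≥ −ε₀` (`re_shapeLaplace_shape_nonneg`, from the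
  convexity of `tri · e^{−a·}`, `a ≥ 0`, and Pólya's criterion `LaplaceShape.integral_mul_cos_nonneg`);
* `testFn x₀ ε₂ ε₀ L α u = e^{αu/L} h(u/L)` — the function fed to the explicit formula (Heath-Brown's
  shift `e^{αt} f(t)` of (6.3) and scaling `f(L⁻¹ log n)`), with `IsSmoothedEFTest` and the Laplace
  transform `F(z) = L · H(zL − α)` (`fordLaplace_testFn`), `H = LaplaceShape.shapeLaplace h x₀`.

## References

* D. R. Heath-Brown, Proc. London Math. Soc. (3) 64 (1992), §6 (6.3), §7 Conditions 1–2, §8 Lemma 8.1.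
  [cite: HeathBrown1992PLMS, Sections 6-8]
-/

noncomputable section

open Complex Real MeasureTheory Set intervalIntegral Filter Topology

namespace Literature.NumberTheory.LFunctions

namespace DHTest

open LaplaceShape

variable {x₀ ε₂ ε₀ L α : ℝ}

/-! ### The plateau `ψ` -/

/-- `ψ(t) = smoothTransition((x₀ − t)/ε₂)`. [cite: HeathBrown1992PLMS, Section 7] -/
def plateau (x₀ ε₂ t : ℝ) : ℝ := Real.smoothTransition ((x₀ - t) / ε₂)

/-- `ψ` is smooth. [folklore] -/
theorem plateau_contDiff (x₀ ε₂ : ℝ) (m : ℕ) : ContDiff ℝ m (plateau x₀ ε₂) :=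
  Real.smoothTransition.contDiff.comp ((contDiff_const.sub contDiff_id).div_const ε₂)

/-- `ψ` is continuous. [folklore] -/
theorem plateau_continuous (x₀ ε₂ : ℝ) : Continuous (plateau x₀ ε₂) :=
  (plateau_contDiff x₀ ε₂ 0).continuous

/-- `ψ ≥ 0`. [folklore] -/
theorem plateau_nonneg (x₀ ε₂ t : ℝ) : 0 ≤ plateau x₀ ε₂ t := Real.smoothTransition.nonneg _

/-- `ψ ≤ 1`. [folklore] -/
theorem plateau_le_one (x₀ ε₂ t : ℝ) : plateau x₀ ε₂ t ≤ 1 := Real.smoothTransition.le_one _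

/-- `ψ = 1` on `(−∞, x₀ − ε₂]`. [folklore] -/
theorem plateau_eq_one (hε : 0 < ε₂) {t : ℝ} (ht : t ≤ x₀ - ε₂) : plateau x₀ ε₂ t = 1 :=
  Real.smoothTransition.one_of_one_le ((one_le_div hε).2 (by linarith))

/-- `ψ = 0` on `[x₀, ∞)`. [folklore] -/
theorem plateau_eq_zero (hε : 0 < ε₂) {t : ℝ} (ht : x₀ ≤ t) : plateau x₀ ε₂ t = 0 :=
  Real.smoothTransition.zero_of_nonpos (div_nonpos_of_nonpos_of_nonneg (by linarith) hε.le)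

/-- `ψ` is decreasing. [folklore] -/
theorem plateau_antitone (hε : 0 < ε₂) : Antitone (plateau x₀ ε₂) := fun a b hab ↦
  Real.smoothTransition.monotone (div_le_div_of_nonneg_right (by linarith) hε.le)

/-- `ψ' ≤ 0`. [folklore] -/
theorem deriv_plateau_nonpos (hε : 0 < ε₂) (t : ℝ) : deriv (plateau x₀ ε₂) t ≤ 0 :=
  (plateau_antitone hε).deriv_nonpos

/-- `ψ` is differentiable. [folklore] -/
theorem hasDerivAt_plateau (x₀ ε₂ t : ℝ) :
    HasDerivAt (plateau x₀ ε₂) (deriv (plateau x₀ ε₂) t) t :=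
  (((plateau_contDiff x₀ ε₂ 1).differentiable (by simp)) t).hasDerivAt

/-- `ψ'` is continuous. [folklore] -/
theorem deriv_plateau_continuous (x₀ ε₂ : ℝ) : Continuous (deriv (plateau x₀ ε₂)) :=
  (plateau_contDiff x₀ ε₂ 1).continuous_deriv (by simp)

/-! ### The smoothed triangle `tri` -/

/-- `tri(t) = ∫_t^{x₀} ψ(u) du`. [cite: HeathBrown1992PLMS, Lemma 8.1 (f(t) = x₀ - t, smoothed)] -/
def tri (x₀ ε₂ t : ℝ) : ℝ := ∫ u in t..x₀, plateau x₀ ε₂ u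

/-- `tri' = −ψ`. [folklore] -/
theorem hasDerivAt_tri (x₀ ε₂ t : ℝ) : HasDerivAt (tri x₀ ε₂) (-plateau x₀ ε₂ t) t :=
  intervalIntegral.integral_hasDerivAt_left ((plateau_continuous x₀ ε₂).intervalIntegrable _ _)
    ((plateau_continuous x₀ ε₂).stronglyMeasurableAtFilter _ _) (plateau_continuous x₀ ε₂).continuousAt

/-- `tri' = −ψ` as functions. [folklore] -/
theorem deriv_tri (x₀ ε₂ : ℝ) : deriv (tri x₀ ε₂) = fun t ↦ -plateau x₀ ε₂ t :=
  funext fun t ↦ (hasDerivAt_tri x₀ ε₂ t).deriv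

/-- `tri` is smooth. [folklore] -/
theorem tri_contDiff (x₀ ε₂ : ℝ) (m : ℕ) : ContDiff ℝ m (tri x₀ ε₂) := by
  have h : ContDiff ℝ ((m : ℕ∞) + 1 : ℕ∞) (tri x₀ ε₂) := by
    rw [show (((m : ℕ∞) + 1 : ℕ∞) : WithTop ℕ∞) = (m : WithTop ℕ∞) + 1 by norm_cast,
      contDiff_succ_iff_deriv]
    refine ⟨fun t ↦ (hasDerivAt_tri x₀ ε₂ t).differentiableAt, fun h ↦ ?_, ?_⟩
    · exact absurd h (by norm_cast)
    · rw [deriv_tri]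
      exact (plateau_contDiff x₀ ε₂ m).neg
  exact h.of_le (by exact_mod_cast le_self_add)

/-- `tri` is continuous. [folklore] -/
theorem tri_continuous (x₀ ε₂ : ℝ) : Continuous (tri x₀ ε₂) := (tri_contDiff x₀ ε₂ 0).continuous

/-- `tri = 0` on `[x₀, ∞)`. [folklore] -/
theorem tri_eq_zero (hε : 0 < ε₂) {t : ℝ} (ht : x₀ ≤ t) : tri x₀ ε₂ t = 0 := by
  rw [tri]
  have h : ∫ u in t..x₀, plateau x₀ ε₂ u = ∫ _ in t..x₀, (0 : ℝ) :=
    intervalIntegral.integral_congr fun u hu ↦ by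
      rw [uIcc_of_ge ht] at hu
      exact plateau_eq_zero hε hu.1
  rw [h, intervalIntegral.integral_zero]

/-- `tri ≥ 0`. [folklore] -/
theorem tri_nonneg (hε : 0 < ε₂) (t : ℝ) : 0 ≤ tri x₀ ε₂ t := by
  rcases le_or_gt t x₀ with ht | ht
  · exact intervalIntegral.integral_nonneg ht fun u _ ↦ plateau_nonneg _ _ _
  · rw [tri_eq_zero hε ht.le]

/-- `tri(t) ≤ x₀ − t` for `t ≤ x₀`. [folklore] -/
theorem tri_le (x₀ ε₂ : ℝ) {t : ℝ} (ht : t ≤ x₀) : tri x₀ ε₂ t ≤ x₀ - t := by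
  have h := intervalIntegral.integral_mono_on (μ := volume) ht
    ((plateau_continuous x₀ ε₂).intervalIntegrable _ _)
    (continuous_const.intervalIntegrable _ _) fun u _ ↦ plateau_le_one x₀ ε₂ u
  simpa [tri] using h

/-- `tri(t) ≥ x₀ − ε₂ − t` for `t ≤ x₀ − ε₂`. [folklore] -/
theorem tri_ge (hε : 0 < ε₂) {t : ℝ} (ht : t ≤ x₀ - ε₂) : x₀ - ε₂ - t ≤ tri x₀ ε₂ t := by
  have hint := (plateau_continuous x₀ ε₂).intervalIntegrable (μ := volume)
  have hsplit : tri x₀ ε₂ t = (∫ u in t..(x₀ - ε₂), plateau x₀ ε₂ u) +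
      ∫ u in (x₀ - ε₂)..x₀, plateau x₀ ε₂ u := by
    rw [tri, intervalIntegral.integral_add_adjacent_intervals (hint _ _) (hint _ _)]
  have h1 : ∫ u in t..(x₀ - ε₂), plateau x₀ ε₂ u = x₀ - ε₂ - t := by
    rw [intervalIntegral.integral_congr (g := fun _ ↦ (1 : ℝ)) fun u hu ↦ by
      rw [uIcc_of_le ht] at hu
      exact plateau_eq_one hε hu.2]
    simp
  have h2 : 0 ≤ ∫ u in (x₀ - ε₂)..x₀, plateau x₀ ε₂ u :=
    intervalIntegral.integral_nonneg (by linarith) fun u _ ↦ plateau_nonneg _ _ _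
  linarith

/-- `tri(0) ∈ [x₀ − ε₂, x₀]` (`0 ≤ x₀ − ε₂`). [folklore] -/
theorem tri_zero_mem (hε : 0 < ε₂) (hx : ε₂ ≤ x₀) : tri x₀ ε₂ 0 ∈ Icc (x₀ - ε₂) x₀ :=
  ⟨by simpa using tri_ge hε (t := 0) (by linarith), by simpa using tri_le x₀ ε₂ (t := 0) (by linarith)⟩

/-! ### The shape `h = tri · e^{−ε₀ t}` and its positivity -/

/-- `h(t) = tri(t) e^{−ε₀ t}`. [cite: HeathBrown1992PLMS, Section 7 (Condition 2)] -/
def shape (x₀ ε₂ ε₀ t : ℝ) : ℝ := tri x₀ ε₂ t * Real.exp (-(ε₀ * t))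

/-- `h` is smooth. [folklore] -/
theorem shape_contDiff (x₀ ε₂ ε₀ : ℝ) (m : ℕ) : ContDiff ℝ m (shape x₀ ε₂ ε₀) :=
  (tri_contDiff x₀ ε₂ m).mul (contDiff_const.mul contDiff_id).neg.exp

/-- `h` is continuous. [folklore] -/
theorem shape_continuous (x₀ ε₂ ε₀ : ℝ) : Continuous (shape x₀ ε₂ ε₀) :=
  (shape_contDiff x₀ ε₂ ε₀ 0).continuous

/-- `h = 0` on `[x₀, ∞)`. [folklore] -/
theorem shape_eq_zero (hε : 0 < ε₂) {t : ℝ} (ht : x₀ ≤ t) : shape x₀ ε₂ ε₀ t = 0 := by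
  rw [shape, tri_eq_zero hε ht, zero_mul]

/-- `h ≥ 0`. [folklore] -/
theorem shape_nonneg (hε : 0 < ε₂) (t : ℝ) : 0 ≤ shape x₀ ε₂ ε₀ t :=
  mul_nonneg (tri_nonneg hε t) (Real.exp_nonneg _)

/-- `h(0) = tri(0)`. [folklore] -/
theorem shape_zero (x₀ ε₂ ε₀ : ℝ) : shape x₀ ε₂ ε₀ 0 = tri x₀ ε₂ 0 := by
  rw [shape, mul_zero, neg_zero, Real.exp_zero, mul_one]

/-- `h ≤ tri` on `[0, ∞)` (`ε₀ ≥ 0`). [folklore] -/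
theorem shape_le_tri (hε : 0 < ε₂) (hε₀ : 0 ≤ ε₀) {t : ℝ} (ht : 0 ≤ t) : shape x₀ ε₂ ε₀ t ≤ tri x₀ ε₂ t := by
  rw [shape]
  refine mul_le_of_le_one_right (tri_nonneg hε t) (Real.exp_le_one_iff.2 ?_)
  nlinarith

/-- **Condition 2 with room**: `Re ∫₀^{x₀} h(t) e^{−wt} dt ≥ 0` for `Re w ≥ −ε₀` (convexity of
`tri(t) e^{−at}`, `a = Re w + ε₀ ≥ 0`, and Pólya's criterion). [cite: HeathBrown1992PLMS, Section 7 (Condition 2)] -/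
theorem re_shapeLaplace_shape_nonneg (hx₀ : 0 ≤ x₀) (hε : 0 < ε₂) {w : ℂ} (hw : -ε₀ ≤ w.re) :
    0 ≤ (shapeLaplace (shape x₀ ε₂ ε₀) x₀ w).re := by
  set a : ℝ := w.re + ε₀ with ha
  have ha0 : 0 ≤ a := by rw [ha]; linarith
  set y : ℝ := w.im with hy
  have hw' : w = (w.re : ℂ) + y * I := (Complex.re_add_im w).symm
  rw [hw', re_shapeLaplace_eq _ (shape_continuous x₀ ε₂ ε₀)]
  -- the convex function `φ = tri · e^{−a·}` and its derivatives
  set φ : ℝ → ℝ := fun t ↦ tri x₀ ε₂ t * Real.exp (-(a * t)) with hφ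
  set φ' : ℝ → ℝ := fun t ↦ (-plateau x₀ ε₂ t - a * tri x₀ ε₂ t) * Real.exp (-(a * t)) with hφ'
  set φ'' : ℝ → ℝ := fun t ↦ (-deriv (plateau x₀ ε₂) t + 2 * a * plateau x₀ ε₂ t + a ^ 2 * tri x₀ ε₂ t) *
    Real.exp (-(a * t)) with hφ''
  have hexp : ∀ t, HasDerivAt (fun t : ℝ ↦ Real.exp (-(a * t))) (-a * Real.exp (-(a * t))) t := by
    intro t
    have := ((hasDerivAt_id' t).const_mul a).neg.exp
    simpa [mul_comm] using this
  have h1 : ∀ t, HasDerivAt φ (φ' t) t := fun t ↦ by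
    have h := (hasDerivAt_tri x₀ ε₂ t).mul (hexp t)
    have e : -plateau x₀ ε₂ t * Real.exp (-(a * t)) + tri x₀ ε₂ t * (-a * Real.exp (-(a * t))) = φ' t := by
      simp only [hφ']; ring
    rw [← e]
    exact h
  have h2 : ∀ t, HasDerivAt φ' (φ'' t) t := fun t ↦ by
    have hd : HasDerivAt (fun t ↦ -plateau x₀ ε₂ t - a * tri x₀ ε₂ t)
        (-deriv (plateau x₀ ε₂) t - a * -plateau x₀ ε₂ t) t :=
      (hasDerivAt_plateau x₀ ε₂ t).neg.sub ((hasDerivAt_tri x₀ ε₂ t).const_mul a)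
    have h := hd.mul (hexp t)
    have e : (-deriv (plateau x₀ ε₂) t - a * -plateau x₀ ε₂ t) * Real.exp (-(a * t)) +
        (-plateau x₀ ε₂ t - a * tri x₀ ε₂ t) * (-a * Real.exp (-(a * t))) = φ'' t := by
      simp only [hφ'']; ring
    rw [← e]
    exact h
  have h3 : Continuous φ'' :=
    (((deriv_plateau_continuous x₀ ε₂).neg.add (continuous_const.mul (plateau_continuous x₀ ε₂))).add
      (continuous_const.mul (tri_continuous x₀ ε₂))).mul (by fun_prop)
  have h4 : ∀ t ∈ Icc 0 x₀, 0 ≤ φ'' t := by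
    intro t _
    simp only [hφ'']
    refine mul_nonneg ?_ (Real.exp_nonneg _)
    have e1 := deriv_plateau_nonpos (x₀ := x₀) hε t
    have e2 := plateau_nonneg x₀ ε₂ t
    have e3 := tri_nonneg (x₀ := x₀) hε t
    nlinarith [mul_nonneg ha0 e2, mul_nonneg (sq_nonneg a) e3]
  have h5 : φ x₀ = 0 := by simp [hφ, tri_eq_zero hε le_rfl]
  have h6 : φ' x₀ = 0 := by simp [hφ', tri_eq_zero hε le_rfl, plateau_eq_zero hε le_rfl]
  have key := integral_mul_cos_nonneg hx₀ h1 h2 h3 h4 h5 h6 y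
  refine key.trans_eq (intervalIntegral.integral_congr fun t _ ↦ ?_)
  simp only [hφ, shape, ha]
  rw [show -((w.re + ε₀) * t) = -(ε₀ * t) + -(w.re * t) by ring, Real.exp_add]
  ring

/-! ### The test function `g(u) = e^{αu/L} h(u/L)` -/

/-- `g(u) = e^{αu/L} h(u/L)`: Heath-Brown's `e^{αt} f(t)` at `t = L⁻¹ log n`.
[cite: HeathBrown1992PLMS, (6.3) and Lemma 5.1] -/
def testFn (x₀ ε₂ ε₀ L α u : ℝ) : ℝ := Real.exp (α * u / L) * shape x₀ ε₂ ε₀ (u / L)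

/-- `g` is smooth. [folklore] -/
theorem testFn_contDiff (x₀ ε₂ ε₀ L α : ℝ) (m : ℕ) : ContDiff ℝ m (testFn x₀ ε₂ ε₀ L α) :=
  ((contDiff_const.mul contDiff_id).div_const L).exp.mul ((shape_contDiff x₀ ε₂ ε₀ m).comp
    (contDiff_id.div_const L))

/-- `g` is continuous. [folklore] -/
theorem testFn_continuous (x₀ ε₂ ε₀ L α : ℝ) : Continuous (testFn x₀ ε₂ ε₀ L α) :=
  (testFn_contDiff x₀ ε₂ ε₀ L α 0).continuous

/-- `g = 0` on `[x₀L, ∞)`. [folklore] -/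
theorem testFn_eq_zero (hε : 0 < ε₂) (hL : 0 < L) {u : ℝ} (hu : x₀ * L ≤ u) :
    testFn x₀ ε₂ ε₀ L α u = 0 := by
  rw [testFn, shape_eq_zero hε ((le_div_iff₀ hL).2 hu), mul_zero]

/-- `g(0) = tri(0) = h(0)`. [folklore] -/
theorem testFn_zero (x₀ ε₂ ε₀ L α : ℝ) : testFn x₀ ε₂ ε₀ L α 0 = tri x₀ ε₂ 0 := by
  rw [testFn, mul_zero, zero_div, Real.exp_zero, one_mul, shape_zero]

/-- `g ≥ 0`. [folklore] -/
theorem testFn_nonneg (hε : 0 < ε₂) (u : ℝ) : 0 ≤ testFn x₀ ε₂ ε₀ L α u :=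
  mul_nonneg (Real.exp_nonneg _) (shape_nonneg hε _)

/-- `g` is an admissible smoothing for the exact explicit formulae (`C^∞`, `= 0` on `[x₀L, ∞)`,
all derivatives vanishing at `x₀L`). [cite: Ford2002Millennium, Lemma 4.5 (Remark)] -/
theorem isSmoothedEFTest_testFn (hx₀ : 0 ≤ x₀) (hε : 0 < ε₂) (hL : 0 < L) :
    IsSmoothedEFTest (testFn x₀ ε₂ ε₀ L α) (testFn x₀ ε₂ ε₀ L α) (deriv (testFn x₀ ε₂ ε₀ L α))
      (deriv (deriv (testFn x₀ ε₂ ε₀ L α))) (x₀ * L) where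
  cont := testFn_continuous x₀ ε₂ ε₀ L α
  x₀_nonneg := mul_nonneg hx₀ hL.le
  eqOn := fun _ _ ↦ rfl
  eq_zero := fun _ hu ↦ testFn_eq_zero hε hL hu
  hasDerivAt := fun t ↦ (((testFn_contDiff x₀ ε₂ ε₀ L α 1).differentiable (by simp)) t).hasDerivAt
  hasDerivAt' := fun t ↦ by
    have h := (testFn_contDiff x₀ ε₂ ε₀ L α 2).differentiable_iteratedDeriv' 1
    rw [iteratedDeriv_one] at h
    exact (h t).hasDerivAt
  cont'' := by
    have h := (testFn_contDiff x₀ ε₂ ε₀ L α 2).continuous_iteratedDeriv 2 le_rfl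
    rwa [iteratedDeriv_succ, iteratedDeriv_one] at h
  p_x₀ := testFn_eq_zero hε hL le_rfl
  p'_x₀ := by
    have h := iteratedDeriv_eq_zero_of_eq_zero (testFn_contDiff x₀ ε₂ ε₀ L α)
      (fun u hu ↦ testFn_eq_zero hε hL hu) 1
    rwa [iteratedDeriv_one] at h

/-- **The Laplace transform of `g`**: `F(z) = ∫₀^∞ g(u) e^{−zu} du = L · H(zL − α)` with
`H(w) = ∫₀^{x₀} h(t) e^{−wt} dt`. [cite: HeathBrown1992PLMS, Lemma 5.1 (F(z) and the shift (6.3))] -/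
theorem fordLaplace_testFn (hx₀ : 0 ≤ x₀) (hε : 0 < ε₂) (hL : 0 < L) (z : ℂ) :
    fordLaplace (testFn x₀ ε₂ ε₀ L α) z =
      L * shapeLaplace (shape x₀ ε₂ ε₀) x₀ (z * L - α) := by
  rw [fordLaplace_eq_intervalIntegral (mul_nonneg hx₀ hL.le) (fun _ _ ↦ rfl)
    (fun u hu ↦ testFn_eq_zero hε hL hu) (testFn_continuous x₀ ε₂ ε₀ L α) z, shapeLaplace]
  -- substitute `u = L t`
  have hsub := intervalIntegral.integral_comp_div
    (f := fun t : ℝ ↦ (shape x₀ ε₂ ε₀ t : ℂ) * Complex.exp (-((z * L - α) * t))) (a := 0) (b := x₀ * L)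
    hL.ne'
  rw [zero_div, mul_div_cancel_right₀ _ hL.ne', Complex.real_smul] at hsub
  rw [← hsub]
  refine intervalIntegral.integral_congr fun u _ ↦ ?_
  simp only [testFn]
  push_cast
  have hL' : (L : ℂ) ≠ 0 := by exact_mod_cast hL.ne'
  rw [show -((z * (L : ℂ) - α) * ((u : ℂ) / L)) = (α : ℂ) * u / L + -(z * u) by field_simp; ring,
    Complex.exp_add]
  ring

end DHTest

end Literature.NumberTheory.LFunctions

end
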